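import Summits.CriticalPhenomena.PercolationContinuityZ3.Theorems.PercNearOneGluingNoHeavyLowerTailSahiTangentPairCoeff

/-!
# `NoHeavyLowerTail` (crux stmt-CriticalPhenomena-4575), Sahi programme: **THE COIN EXPANSION OF SAHI'S `E_n` FOR AN ARBITRARY PAIR
# FAMILY, AT EVERY ORDER** — `E_n^{B_s⊗μ}(ε ? g¹ : g⁰) = Σ_{π} Σ_{Ψ ⊆ π} ψ_{|Ψ|,|π∖Ψ|}(s) · Π_{B∈Ψ} (E(g¹|_B) − E(g⁰|_B)) · Π_{B∈π∖Ψ} E(g⁰|_B)`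
# with NONNEGATIVE coefficients `ψ_{i,j}(s) = s(1−s)(2−s)⋯(i−1−s)·(i−1)i⋯(i+j−2)` (`i ≥ 2`), `ψ_{1,0} = s`, `ψ_{0,1} = 1`

Support file (Sahi cell, seat `prim-sahi-p1`, generation 51; `--supports stmt-CriticalPhenomena-4575`).  Companions: `…SahiTangentScaling`
(the case `g⁰ = 0`), `…SahiTangentPairCoeff` (the coefficients `ψ = pairCoeff`, colourings, `pairTerm`/`pairSum`).  Pure proofs plus one
bookkeeping definition (`pairTermSum`); no `sorry`, standard axioms.

THE IDENTITY (new, all orders).  Let `μ` be ANY real weight on a finite type `α`, `s` any real, and `g¹, g⁰ : Fin n → α → ℝ` two families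
(`n ≥ 1`).  On the coin space `Bool × α` with the weight `B_s ⊗ μ` (`(1,x) ↦ s·μ(x)`, `(0,x) ↦ (1−s)·μ(x)`) consider the PAIR FAMILY
`F_l(ε,x) = ε ? g¹_l(x) : g⁰_l(x)` (top section `g¹_l`, bottom section `g⁰_l`; in percolation: the two sections of an event at an extra
independent edge of probability `s`).  With `E(h|_B)` = Sahi's `E_{|B|}^{μ}` of the sub-family indexed by the block `B` and
`Δ_B := E(g¹|_B) − E(g⁰|_B)`:
`E_n^{B_s⊗μ}(F) = Σ_{π set partition of [n]} Σ_{Ψ ⊆ blocks(π)} ψ_{|Ψ|, |π|−|Ψ|}(s) · Π_{B∈Ψ} Δ_B · Π_{B∉Ψ} E(g⁰|_B)`     (`sahiE_coin_pair`),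
`ψ_{i,j}(s) = φ_i(s)·(i−1)i⋯(i+j−2)` for `i ≥ 2` (`φ_i(s) = s(1−s)⋯(i−1−s)`), `ψ_{1,0} = s`, `ψ_{1,j} = 0` (`j ≥ 1`), `ψ_{0,1} = 1`,
`ψ_{0,j} = 0` (`j ≠ 1`); ALL `ψ_{i,j}(s) ≥ 0` FOR `0 ≤ s ≤ 1` (`pairCoeff_nonneg`).  The one-block terms are `s·E_n(g¹) + (1−s)·E_n(g⁰)`;
`g⁰ = 0` recovers the scaling identity; `g⁰ = g¹` off a set `L` of slots and `0` on `L` gives the mixed VERTICES of Conjecture T_n; the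
general consequence is the monotone-correlation criterion for Conjecture T_n (companion file `…SahiTangentPairCriterion`).
MECHANISM: `1 − G_{B_s⊗μ}(F) = (1 − G¹)^s (1 − G⁰)^{1−s}` [Sahi2008, proof of Thm. 1, eq. (12)], polarised; not in print at the `E_n` level.

PROOF here: recursion only, same skeleton as `…SahiTangentScaling`, summands indexed by (ordered finpartition `c`, colouring
`χ : blocks → Bool`).  Under `OrderedFinpartition.extendEquiv`: `0` a singleton block contributes `ψ_{i+1,j}·(E g¹_0 − E g⁰_0)` or
`ψ_{i,j+1}·E g⁰_0` (`sum_pairTerm_extendLeft`); `0` inserted into a `Δ`-block `B`: `Δ_{0∪B} = Σ_{l∈B} Δ^{(l)}_B − E(g¹_0)·Δ_B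
− (E g¹_0 − E g⁰_0)·E(g⁰|_B)` (Lieb–Sahi recursion for both families; the last term CHANGES THE COLOUR of `B` and is regrouped by the
involution flipping `χ` at that block, `sum_flip`); into an `E⁰`-block: `E(g⁰_0; g⁰|_B) = Σ_l E(g⁰^{(l)}|_B) − E(g⁰_0)E(g⁰|_B)`
(`sum_pairTerm_extendMiddle`).  The recursion closes by the coefficient identities (I1), (I2) of `…SahiTangentPairCoeff`.
Nothing conjectural is asserted. [this work]
-/

namespace Summit.CriticalPhenomena.PercolationContinuityZ3.Theorems.SahiTangent

open Finset Function Literature.Combinatorics.Sahi2008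
open scoped BigOperators

noncomputable section

variable {α : Type*} [Fintype α] {n : ℕ}

/-! ### §4 The recursion for the pair expansion -/

section Recursion

variable (μ : α → ℝ) (s : ℝ) (g₁ g₀ : Fin (n + 1) → α → ℝ) (c : OrderedFinpartition n)

/-- Singleton block coloured `true`: `ψ_{i+1,j}·(E g¹_0 − E g⁰_0)·Π(tail)`. [this work] -/
theorem pairTerm_extendLeft_true (χ : Fin c.length → Bool) :
    pairTerm μ s g₁ g₀ c.extendLeft (Fin.cons true χ : Fin (c.length + 1) → Bool) =
      pairCoeff s (cT χ + 1) (cF χ) * ((ex μ (g₁ 0) - ex μ (g₀ 0)) * ∏ m : Fin c.length, cbf μ (Fin.tail g₁) (Fin.tail g₀) c χ m) := by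
  show pairCoeff s (cT (Fin.cons true χ : Fin (c.length + 1) → Bool)) (cF (Fin.cons true χ : Fin (c.length + 1) → Bool)) *
      ∏ m : Fin (c.length + 1), cbf μ g₁ g₀ c.extendLeft (Fin.cons true χ : Fin (c.length + 1) → Bool) m = _
  rw [cT_cons_true, cF_cons_true]
  congr 1
  rw [Fin.prod_univ_succ]
  rfl

/-- Singleton block coloured `false`: `ψ_{i,j+1}·E(g⁰_0)·Π(tail)`. [this work] -/
theorem pairTerm_extendLeft_false (χ : Fin c.length → Bool) :
    pairTerm μ s g₁ g₀ c.extendLeft (Fin.cons false χ : Fin (c.length + 1) → Bool) =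
      pairCoeff s (cT χ) (cF χ + 1) * (ex μ (g₀ 0) * ∏ m : Fin c.length, cbf μ (Fin.tail g₁) (Fin.tail g₀) c χ m) := by
  show pairCoeff s (cT (Fin.cons false χ : Fin (c.length + 1) → Bool)) (cF (Fin.cons false χ : Fin (c.length + 1) → Bool)) *
      ∏ m : Fin (c.length + 1), cbf μ g₁ g₀ c.extendLeft (Fin.cons false χ : Fin (c.length + 1) → Bool) m = _
  rw [cT_cons_false, cF_cons_false]
  congr 1
  rw [Fin.prod_univ_succ]
  rfl

/-- The sum over all colourings of the singleton extension. [this work] -/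
theorem sum_pairTerm_extendLeft :
    ∑ χ' : Fin c.extendLeft.length → Bool, pairTerm μ s g₁ g₀ c.extendLeft χ' =
      ∑ χ : Fin c.length → Bool,
        (pairCoeff s (cT χ + 1) (cF χ) * (ex μ (g₁ 0) - ex μ (g₀ 0)) + pairCoeff s (cT χ) (cF χ + 1) * ex μ (g₀ 0)) *
          ∏ m : Fin c.length, cbf μ (Fin.tail g₁) (Fin.tail g₀) c χ m := by
  show ∑ χ' : Fin (c.length + 1) → Bool, pairTerm μ s g₁ g₀ c.extendLeft χ' = _
  rw [← Fintype.sum_equiv (Fin.consEquiv fun _ : Fin (c.length + 1) => Bool)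
      (fun p => pairTerm μ s g₁ g₀ c.extendLeft (Fin.cons p.1 p.2 : Fin (c.length + 1) → Bool)) _ (fun p => rfl),
    Fintype.sum_prod_type, Fintype.sum_bool, ← sum_add_distrib]
  refine sum_congr rfl fun χ _ => ?_
  have ht := pairTerm_extendLeft_true μ s g₁ g₀ c χ
  have hf := pairTerm_extendLeft_false μ s g₁ g₀ c χ
  dsimp only at ht hf ⊢
  rw [ht, hf]
  ring

/-- The coloured factors of `c.extendMiddle k₀` off block `k₀` are those of the tails. [this work] -/
theorem cbf_extendMiddle_ne (χ : Fin c.length → Bool) (k₀ : Fin c.length) {m : Fin c.length} (hm : m ≠ k₀) :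
    cbf μ g₁ g₀ (c.extendMiddle k₀) χ m = cbf μ (Fin.tail g₁) (Fin.tail g₀) c χ m := by
  unfold cbf
  rw [blockE_extendMiddle_ne μ g₁ c k₀ hm, blockE_extendMiddle_ne μ g₀ c k₀ hm]

/-- The coloured factors of the modified families (slot `c.emb k₀ j` absorbing the heads) off block `k₀` are those of the tails.
[this work] -/
theorem cbf_update_ne (χ : Fin c.length → Bool) (k₀ : Fin c.length) (j : Fin (c.partSize k₀)) {m : Fin c.length} (hm : m ≠ k₀) :
    cbf μ (update (Fin.tail g₁) (c.emb k₀ j) (Fin.tail g₁ (c.emb k₀ j) * g₁ 0))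
        (update (Fin.tail g₀) (c.emb k₀ j) (Fin.tail g₀ (c.emb k₀ j) * g₀ 0)) c χ m =
      cbf μ (Fin.tail g₁) (Fin.tail g₀) c χ m := by
  unfold cbf
  rw [blockE_update_ne μ (Fin.tail g₁) (g₁ 0) c k₀ j hm, blockE_update_ne μ (Fin.tail g₀) (g₀ 0) c k₀ j hm]

/-- Recolouring block `k₀` `false` does not change the other factors. [this work] -/
theorem cbf_recolour_ne (G₁ G₀ : Fin n → α → ℝ) (χ : Fin c.length → Bool) (k₀ : Fin c.length) {m : Fin c.length} (hm : m ≠ k₀) :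
    cbf μ G₁ G₀ c (update χ k₀ false) m = cbf μ G₁ G₀ c χ m := by
  unfold cbf
  rw [update_of_ne hm]

/-- The involution flipping the colour of block `k₀`. [this work] -/
def flipColour {k : ℕ} (k₀ : Fin k) : (Fin k → Bool) ≃ (Fin k → Bool) :=
  Function.Involutive.toPerm (fun χ => update χ k₀ (!χ k₀)) fun χ => by
    show update (update χ k₀ (!χ k₀)) k₀ (!(update χ k₀ (!χ k₀)) k₀) = χ
    rw [update_self, Bool.not_not, update_idem, update_eq_self]

/-- Reindexing a sum over colourings by the flip at `k₀`: `Σ_{χ : χ(k₀)} A(χ with k₀ ↦ false) = Σ_{χ : ¬χ(k₀)} A(χ)`.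
[this work] -/
theorem sum_flip {k : ℕ} (k₀ : Fin k) (A : (Fin k → Bool) → ℝ) :
    ∑ χ : Fin k → Bool, (if χ k₀ then A (update χ k₀ false) else 0) = ∑ χ : Fin k → Bool, (if χ k₀ then 0 else A χ) := by
  refine Fintype.sum_equiv (flipColour k₀) _ _ fun χ => ?_
  show (if χ k₀ = true then A (update χ k₀ false) else 0) =
    if (update χ k₀ (!χ k₀)) k₀ = true then 0 else A (update χ k₀ (!χ k₀))
  rw [update_self]
  cases χ k₀ <;> simp

/-- **The sum over "insert `0` into a block" for the pair expansion** (one set partition `c` of the tail, all colourings): the block of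
`0` expanded by the Lieb–Sahi recursion for both families; the colour-changing term regrouped by the flip. [this work] -/
theorem sum_pairTerm_extendMiddle :
    ∑ k₀ : Fin c.length, ∑ χ : Fin (c.extendMiddle k₀).length → Bool, pairTerm μ s g₁ g₀ (c.extendMiddle k₀) χ =
      (∑ i : Fin n, ∑ χ : Fin c.length → Bool,
          pairTerm μ s (update (Fin.tail g₁) i (Fin.tail g₁ i * g₁ 0)) (update (Fin.tail g₀) i (Fin.tail g₀ i * g₀ 0)) c χ) -
        ∑ χ : Fin c.length → Bool,
          (pairCoeff s (cT χ) (cF χ) * ((cT χ : ℝ) * ex μ (g₁ 0) + (cF χ : ℝ) * ex μ (g₀ 0)) +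
              (cF χ : ℝ) * pairCoeff s (cT χ + 1) (cF χ - 1) * (ex μ (g₁ 0) - ex μ (g₀ 0))) *
            ∏ m : Fin c.length, cbf μ (Fin.tail g₁) (Fin.tail g₀) c χ m := by
  -- abbreviations
  set m₁ := ex μ (g₁ 0) with hm₁
  set m₀ := ex μ (g₀ 0) with hm₀
  set P : (Fin c.length → Bool) → ℝ := fun χ => ∏ m : Fin c.length, cbf μ (Fin.tail g₁) (Fin.tail g₀) c χ m with hP
  set P' : (Fin c.length → Bool) → Fin c.length → ℝ :=
    fun χ k₀ => ∏ m ∈ univ.erase k₀, cbf μ (Fin.tail g₁) (Fin.tail g₀) c χ m with hP'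
  set U₁ : (k₀ : Fin c.length) → Fin (c.partSize k₀) → ℝ := fun k₀ j => sahiE μ (c.partSize k₀)
    (update (fun r => Fin.tail g₁ (c.emb k₀ r)) j ((fun r : Fin (c.partSize k₀) => Fin.tail g₁ (c.emb k₀ r)) j * g₁ 0)) with hU₁
  set U₀ : (k₀ : Fin c.length) → Fin (c.partSize k₀) → ℝ := fun k₀ j => sahiE μ (c.partSize k₀)
    (update (fun r => Fin.tail g₀ (c.emb k₀ r)) j ((fun r : Fin (c.partSize k₀) => Fin.tail g₀ (c.emb k₀ r)) j * g₀ 0)) with hU₀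
  set E₁ : Fin c.length → ℝ := fun k₀ => blockE μ (Fin.tail g₁) c k₀ with hE₁
  set E₀ : Fin c.length → ℝ := fun k₀ => blockE μ (Fin.tail g₀) c k₀ with hE₀
  -- the full tail product splits off block `k₀`
  have hPsplit : ∀ (χ : Fin c.length → Bool) (k₀ : Fin c.length),
      P χ = (if χ k₀ then E₁ k₀ - E₀ k₀ else E₀ k₀) * P' χ k₀ := by
    intro χ k₀
    simp only [hP, hP', hE₁, hE₀]
    rw [← mul_prod_erase univ _ (mem_univ k₀)]
    rfl
  -- the recoloured product
  have hPflip : ∀ (χ : Fin c.length → Bool) (k₀ : Fin c.length), P (update χ k₀ false) = E₀ k₀ * P' χ k₀ := by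
    intro χ k₀
    simp only [hP, hP', hE₀]
    rw [← mul_prod_erase univ _ (mem_univ k₀)]
    congr 1
    · unfold cbf; rw [update_self]; simp
    · exact prod_congr rfl fun m hm => cbf_recolour_ne μ c _ _ χ k₀ (ne_of_mem_erase hm)
  -- each summand of the middle extension, expanded
  have hterm : ∀ (k₀ : Fin c.length) (χ : Fin c.length → Bool),
      pairTerm μ s g₁ g₀ (c.extendMiddle k₀) χ =
        pairCoeff s (cT χ) (cF χ) *
          ((∑ j : Fin (c.partSize k₀), (if χ k₀ then U₁ k₀ j - U₀ k₀ j else U₀ k₀ j) * P' χ k₀) -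
            (if χ k₀ then m₁ else m₀) * P χ - (if χ k₀ then (m₁ - m₀) * P (update χ k₀ false) else 0)) := by
    intro k₀ χ
    unfold pairTerm
    congr 1
    show ∏ m : Fin c.length, cbf μ g₁ g₀ (c.extendMiddle k₀) χ m = _
    rw [← mul_prod_erase univ _ (mem_univ k₀)]
    have hrest : ∏ m ∈ univ.erase k₀, cbf μ g₁ g₀ (c.extendMiddle k₀) χ m = P' χ k₀ :=
      prod_congr rfl fun m hm => cbf_extendMiddle_ne μ g₁ g₀ c χ k₀ (ne_of_mem_erase hm)
    rw [hrest, hPsplit χ k₀, hPflip χ k₀, ← sum_mul]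
    unfold cbf
    rw [blockE_extendMiddle_self_expand, blockE_extendMiddle_self_expand]
    cases χ k₀ <;> simp [hU₁, hU₀, hE₁, hE₀, hm₁, hm₀] <;> ring
  -- counting heads by colour
  have hcount : ∀ χ : Fin c.length → Bool,
      (∑ k₀ : Fin c.length, (if χ k₀ then m₁ else m₀)) = (cT χ : ℝ) * m₁ + (cF χ : ℝ) * m₀ := by
    intro χ
    rw [cT_cast, cF_cast, sum_mul, sum_mul, ← sum_add_distrib]
    exact sum_congr rfl fun k₀ _ => by split_ifs <;> ring
  have hcount0 : ∀ (χ : Fin c.length → Bool) (a : ℝ), (∑ k₀ : Fin c.length, (if χ k₀ then 0 else a)) = (cF χ : ℝ) * a := by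
    intro χ a
    rw [cF_cast, sum_mul]
    exact sum_congr rfl fun k₀ _ => by split_ifs <;> ring
  -- (M1): the modified families
  have hM1 : (∑ k₀ : Fin c.length, ∑ χ : Fin c.length → Bool,
      pairCoeff s (cT χ) (cF χ) * (∑ j : Fin (c.partSize k₀), (if χ k₀ then U₁ k₀ j - U₀ k₀ j else U₀ k₀ j) * P' χ k₀)) =
      ∑ i : Fin n, ∑ χ : Fin c.length → Bool,
        pairTerm μ s (update (Fin.tail g₁) i (Fin.tail g₁ i * g₁ 0)) (update (Fin.tail g₀) i (Fin.tail g₀ i * g₀ 0)) c χ := by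
    rw [← c.sum_sigma_eq_sum fun i => ∑ χ : Fin c.length → Bool,
      pairTerm μ s (update (Fin.tail g₁) i (Fin.tail g₁ i * g₁ 0)) (update (Fin.tail g₀) i (Fin.tail g₀ i * g₀ 0)) c χ]
    refine sum_congr rfl fun k₀ _ => ?_
    simp_rw [mul_sum]
    rw [sum_comm]
    refine sum_congr rfl fun j _ => sum_congr rfl fun χ _ => ?_
    unfold pairTerm
    congr 1
    rw [← mul_prod_erase univ (fun m => cbf μ (update (Fin.tail g₁) (c.emb k₀ j) (Fin.tail g₁ (c.emb k₀ j) * g₁ 0))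
      (update (Fin.tail g₀) (c.emb k₀ j) (Fin.tail g₀ (c.emb k₀ j) * g₀ 0)) c χ m) (mem_univ k₀)]
    congr 1
    · unfold cbf
      rw [blockE_update_self, blockE_update_self]
    · exact (prod_congr rfl fun m hm => cbf_update_ne μ g₁ g₀ c χ k₀ j (ne_of_mem_erase hm)).symm
  -- (M2): the head moments, counted by colour
  have hM2 : (∑ k₀ : Fin c.length, ∑ χ : Fin c.length → Bool, pairCoeff s (cT χ) (cF χ) * ((if χ k₀ then m₁ else m₀) * P χ)) =
      ∑ χ : Fin c.length → Bool, pairCoeff s (cT χ) (cF χ) * (((cT χ : ℝ) * m₁ + (cF χ : ℝ) * m₀) * P χ) := by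
    rw [sum_comm]
    refine sum_congr rfl fun χ _ => ?_
    rw [← mul_sum, ← sum_mul, hcount]
  -- (M3): the colour-changing term, regrouped by the flip
  have hM3 : (∑ k₀ : Fin c.length, ∑ χ : Fin c.length → Bool,
      pairCoeff s (cT χ) (cF χ) * (if χ k₀ then (m₁ - m₀) * P (update χ k₀ false) else 0)) =
      ∑ χ : Fin c.length → Bool, (cF χ : ℝ) * pairCoeff s (cT χ + 1) (cF χ - 1) * ((m₁ - m₀) * P χ) := by
    have hk : ∀ k₀ : Fin c.length, (∑ χ : Fin c.length → Bool,
        pairCoeff s (cT χ) (cF χ) * (if χ k₀ then (m₁ - m₀) * P (update χ k₀ false) else 0)) =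
        ∑ χ : Fin c.length → Bool, (if χ k₀ then 0 else pairCoeff s (cT χ + 1) (cF χ - 1) * ((m₁ - m₀) * P χ)) := by
      intro k₀
      have hf := sum_flip k₀ (fun χ => pairCoeff s (cT χ + 1) (cF χ - 1) * ((m₁ - m₀) * P χ))
      beta_reduce at hf
      rw [← hf]
      refine sum_congr rfl fun χ _ => ?_
      by_cases h : χ k₀ = true
      · rw [if_pos h, if_pos h, cF_update_false h, Nat.add_sub_cancel]
        congr 2
        exact (cT_update_false h).symm
      · rw [if_neg h, if_neg h, mul_zero]
    simp_rw [hk]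
    rw [sum_comm]
    refine sum_congr rfl fun χ _ => ?_
    rw [hcount0]
    ring
  -- assemble
  show ∑ k₀ : Fin c.length, ∑ χ : Fin c.length → Bool, pairTerm μ s g₁ g₀ (c.extendMiddle k₀) χ = _
  simp_rw [hterm, mul_sub, sum_sub_distrib]
  rw [hM1, hM2, hM3, sub_sub, ← sum_add_distrib]
  congr 1
  exact sum_congr rfl fun χ _ => by ring

end Recursion

/-! ### §5 The recursion assembled, the base case, and the theorem -/

/-- The colour sum of one set partition (bookkeeping). [this work] -/
def pairTermSum (μ : α → ℝ) (s : ℝ) (g₁ g₀ : Fin n → α → ℝ) (c : OrderedFinpartition n) : ℝ :=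
  ∑ χ : Fin c.length → Bool, pairTerm μ s g₁ g₀ c χ

/-- The pair expansion is the sum of the colour sums (bookkeeping). [this work] -/
theorem pairSum_eq_sum_pairTermSum (μ : α → ℝ) (s : ℝ) (n : ℕ) (g₁ g₀ : Fin n → α → ℝ) :
    pairSum μ s n g₁ g₀ = ∑ c : OrderedFinpartition n, pairTermSum μ s g₁ g₀ c := rfl

/-- **The pair expansion satisfies the Lieb–Sahi recursion of the coin family** (head weight `s·E(g¹_0) + (1−s)·E(g⁰_0)`).
[this work] -/
theorem pairSum_succ (μ : α → ℝ) (s : ℝ) (n : ℕ) (g₁ g₀ : Fin (n + 2) → α → ℝ) :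
    pairSum μ s (n + 2) g₁ g₀ =
      (∑ i : Fin (n + 1), pairSum μ s (n + 1) (update (Fin.tail g₁) i (Fin.tail g₁ i * g₁ 0))
          (update (Fin.tail g₀) i (Fin.tail g₀ i * g₀ 0))) -
        (s * ex μ (g₁ 0) + (1 - s) * ex μ (g₀ 0)) * pairSum μ s (n + 1) (Fin.tail g₁) (Fin.tail g₀) := by
  simp only [pairSum_eq_sum_pairTermSum]
  rw [← Fintype.sum_equiv (OrderedFinpartition.extendEquiv (n + 1)) (fun p => pairTermSum μ s g₁ g₀ (p.1.extend p.2))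
      (fun c' => pairTermSum μ s g₁ g₀ c') (fun p => rfl), Fintype.sum_sigma]
  simp_rw [Fintype.sum_option, OrderedFinpartition.extend_none, OrderedFinpartition.extend_some]
  have hc : ∀ c : OrderedFinpartition (n + 1),
      pairTermSum μ s g₁ g₀ c.extendLeft + ∑ k₀ : Fin c.length, pairTermSum μ s g₁ g₀ (c.extendMiddle k₀) =
        (∑ i : Fin (n + 1), pairTermSum μ s (update (Fin.tail g₁) i (Fin.tail g₁ i * g₁ 0))
            (update (Fin.tail g₀) i (Fin.tail g₀ i * g₀ 0)) c) -
          (s * ex μ (g₁ 0) + (1 - s) * ex μ (g₀ 0)) * pairTermSum μ s (Fin.tail g₁) (Fin.tail g₀) c := by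
    intro c
    unfold pairTermSum
    have hAB : (∑ χ : Fin c.length → Bool,
        (pairCoeff s (cT χ + 1) (cF χ) * (ex μ (g₁ 0) - ex μ (g₀ 0)) + pairCoeff s (cT χ) (cF χ + 1) * ex μ (g₀ 0)) *
          ∏ m : Fin c.length, cbf μ (Fin.tail g₁) (Fin.tail g₀) c χ m) -
        (∑ χ : Fin c.length → Bool,
          (pairCoeff s (cT χ) (cF χ) * ((cT χ : ℝ) * ex μ (g₁ 0) + (cF χ : ℝ) * ex μ (g₀ 0)) +
              (cF χ : ℝ) * pairCoeff s (cT χ + 1) (cF χ - 1) * (ex μ (g₁ 0) - ex μ (g₀ 0))) *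
            ∏ m : Fin c.length, cbf μ (Fin.tail g₁) (Fin.tail g₀) c χ m) =
        -((s * ex μ (g₁ 0) + (1 - s) * ex μ (g₀ 0)) * ∑ χ : Fin c.length → Bool, pairTerm μ s (Fin.tail g₁) (Fin.tail g₀) c χ) := by
      rw [← sum_sub_distrib, mul_sum, ← sum_neg_distrib]
      refine sum_congr rfl fun χ _ => ?_
      have hne : ¬(cT χ = 0 ∧ cF χ = 0) := by
        intro h
        have h1 := cT_add_cF χ
        have h2 := c.length_pos (Nat.succ_pos n)
        omega
      have h1 := pairCoeff_I1 s (cT χ) (cF χ) hne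
      have h2 := pairCoeff_I2 s (cT χ) (cF χ) hne
      unfold pairTerm
      linear_combination (∏ m : Fin c.length, cbf μ (Fin.tail g₁) (Fin.tail g₀) c χ m) * (ex μ (g₁ 0) * h1 + ex μ (g₀ 0) * h2)
    rw [sum_pairTerm_extendLeft, sum_pairTerm_extendMiddle]
    linear_combination hAB
  simp_rw [hc]
  rw [sum_sub_distrib, sum_comm, ← mul_sum]

/-- The single block of the unique set partition of `{0}` carries `E(G_0)`. [this work] -/
theorem blockE_atomic_one (μ : α → ℝ) (G : Fin 1 → α → ℝ) :
    blockE μ G (OrderedFinpartition.atomic 1) (0 : Fin 1) = ex μ (G 0) := by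
  rw [blockE_eq μ G (OrderedFinpartition.atomic 1) (0 : Fin 1) (p := 1) rfl (fun _ => G 0) fun r => by
    have hr : r = 0 := Subsingleton.elim r 0
    subst hr
    simp [OrderedFinpartition.atomic]]
  exact sahiE_one_apply μ _

/-- The pair expansion of one pair slot: `s·E(g¹_0) + (1 − s)·E(g⁰_0)`. [this work] -/
theorem pairSum_one (μ : α → ℝ) (s : ℝ) (g₁ g₀ : Fin 1 → α → ℝ) :
    pairSum μ s 1 g₁ g₀ = s * ex μ (g₁ 0) + (1 - s) * ex μ (g₀ 0) := by
  unfold pairSum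
  rw [Fintype.sum_unique, OrderedFinpartition.default_eq]
  show ∑ χ : Fin 1 → Bool, pairTerm μ s g₁ g₀ (OrderedFinpartition.atomic 1) χ = _
  rw [Fintype.sum_equiv (Equiv.funUnique (Fin 1) Bool) (fun χ => pairTerm μ s g₁ g₀ (OrderedFinpartition.atomic 1) χ)
      (fun b => pairTerm μ s g₁ g₀ (OrderedFinpartition.atomic 1) (fun _ => b)) (fun χ => ?_), Fintype.sum_bool]
  · have ht : pairTerm μ s g₁ g₀ (OrderedFinpartition.atomic 1) (fun _ => true) = s * (ex μ (g₁ 0) - ex μ (g₀ 0)) := by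
      show pairCoeff s (cT (fun _ : Fin 1 => true)) (cF (fun _ : Fin 1 => true)) *
          ∏ m : Fin 1, cbf μ g₁ g₀ (OrderedFinpartition.atomic 1) (fun _ => true) m = _
      have h1 : cT (fun _ : Fin 1 => true) = 1 := by unfold cT; simp
      have h2 : cF (fun _ : Fin 1 => true) = 0 := by unfold cF; simp
      rw [h1, h2, pairCoeff_one_left, if_pos rfl, Fin.prod_univ_one]
      unfold cbf
      rw [if_pos rfl, blockE_atomic_one, blockE_atomic_one]
    have hf : pairTerm μ s g₁ g₀ (OrderedFinpartition.atomic 1) (fun _ => false) = ex μ (g₀ 0) := by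
      show pairCoeff s (cT (fun _ : Fin 1 => false)) (cF (fun _ : Fin 1 => false)) *
          ∏ m : Fin 1, cbf μ g₁ g₀ (OrderedFinpartition.atomic 1) (fun _ => false) m = _
      have h1 : cT (fun _ : Fin 1 => false) = 0 := by unfold cT; simp
      have h2 : cF (fun _ : Fin 1 => false) = 1 := by unfold cF; simp
      rw [h1, h2, pairCoeff_zero_left, if_pos rfl, Fin.prod_univ_one, one_mul]
      unfold cbf
      rw [if_neg Bool.false_ne_true, blockE_atomic_one]
    rw [ht, hf]
    ring
  · show pairTerm μ s g₁ g₀ (OrderedFinpartition.atomic 1) χ = pairTerm μ s g₁ g₀ (OrderedFinpartition.atomic 1) fun _ => χ default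
    congr 1
    funext i
    rw [Subsingleton.elim i default]

/-- Expectation of a pair slot under `B_s ⊗ μ`: `s·E(a) + (1 − s)·E(b)`. [this work] -/
theorem ex_coin_pair (μ : α → ℝ) (s : ℝ) (a b : α → ℝ) :
    ex (fun z : Bool × α => if z.1 then s * μ z.2 else (1 - s) * μ z.2) (fun z => if z.1 then a z.2 else b z.2) =
      s * ex μ a + (1 - s) * ex μ b := by
  simp only [ex, Fintype.sum_prod_type, Fintype.sum_bool, if_true, Bool.false_eq_true, if_false, Finset.mul_sum,
    ← Finset.sum_add_distrib]
  exact Finset.sum_congr rfl fun x _ => by ring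

/-- **THE COIN EXPANSION OF `E_n` FOR A PAIR FAMILY (all orders).**  For every finite type, every real weight `μ`, every real `s`, every
`n` and all families `g¹, g⁰` of `n + 1` real functions:
`E_{n+1}^{B_s⊗μ}(ε ? g¹ : g⁰) = Σ_{c} Σ_{χ : blocks(c) → Bool} ψ_{#true, #false}(s) · Π_{χ(B)} (E(g¹|_B) − E(g⁰|_B)) · Π_{¬χ(B)} E(g⁰|_B)`
(sum over Mathlib's ordered finpartitions `c` of `Fin (n+1)` = the set partitions, once each). [this work] -/
theorem sahiE_coin_pair (μ : α → ℝ) (s : ℝ) : ∀ (n : ℕ) (g₁ g₀ : Fin (n + 1) → α → ℝ),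
    sahiE (fun z : Bool × α => if z.1 then s * μ z.2 else (1 - s) * μ z.2) (n + 1)
      (fun l (z : Bool × α) => if z.1 then g₁ l z.2 else g₀ l z.2) = pairSum μ s (n + 1) g₁ g₀
  | 0, g₁, g₀ => by rw [pairSum_one, sahiE_one_apply, ex_coin_pair]
  | n + 1, g₁, g₀ => by
    rw [pairSum_succ, sahiE_succ_succ]
    have hupd : ∀ i : Fin (n + 1),
        update (Fin.tail fun l (z : Bool × α) => if z.1 then g₁ l z.2 else g₀ l z.2) i
          (Fin.tail (fun l (z : Bool × α) => if z.1 then g₁ l z.2 else g₀ l z.2) i *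
            (fun l (z : Bool × α) => if z.1 then g₁ l z.2 else g₀ l z.2) 0) =
        fun l (z : Bool × α) => if z.1 then update (Fin.tail g₁) i (Fin.tail g₁ i * g₁ 0) l z.2
          else update (Fin.tail g₀) i (Fin.tail g₀ i * g₀ 0) l z.2 := by
      intro i
      funext l z
      by_cases h : l = i
      · subst h
        simp only [update_self, Pi.mul_apply, Fin.tail]
        split_ifs <;> rfl
      · simp only [update_of_ne h, Fin.tail]
    have hsum : (∑ i : Fin (n + 1), sahiE (fun z : Bool × α => if z.1 then s * μ z.2 else (1 - s) * μ z.2) (n + 1)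
        (update (Fin.tail fun l (z : Bool × α) => if z.1 then g₁ l z.2 else g₀ l z.2) i
          (Fin.tail (fun l (z : Bool × α) => if z.1 then g₁ l z.2 else g₀ l z.2) i *
            (fun l (z : Bool × α) => if z.1 then g₁ l z.2 else g₀ l z.2) 0))) =
        ∑ i : Fin (n + 1), pairSum μ s (n + 1) (update (Fin.tail g₁) i (Fin.tail g₁ i * g₁ 0))
          (update (Fin.tail g₀) i (Fin.tail g₀ i * g₀ 0)) :=
      sum_congr rfl fun i _ => (congrArg _ (hupd i)).trans (sahiE_coin_pair μ s n _ _)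
    have htl : sahiE (fun z : Bool × α => if z.1 then s * μ z.2 else (1 - s) * μ z.2) (n + 1)
        (Fin.tail fun l (z : Bool × α) => if z.1 then g₁ l z.2 else g₀ l z.2) = pairSum μ s (n + 1) (Fin.tail g₁) (Fin.tail g₀) :=
      sahiE_coin_pair μ s n (Fin.tail g₁) (Fin.tail g₀)
    rw [hsum, htl]
    have h0 : ex (fun z : Bool × α => if z.1 then s * μ z.2 else (1 - s) * μ z.2)
        ((fun l (z : Bool × α) => if z.1 then g₁ l z.2 else g₀ l z.2) 0) = s * ex μ (g₁ 0) + (1 - s) * ex μ (g₀ 0) :=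
      ex_coin_pair μ s (g₁ 0) (g₀ 0)
    rw [h0]
    ring

/-- The same, fully unfolded. [this work] -/
theorem sahiE_coin_pair_eq_sum (μ : α → ℝ) (s : ℝ) (n : ℕ) (g₁ g₀ : Fin (n + 1) → α → ℝ) :
    sahiE (fun z : Bool × α => if z.1 then s * μ z.2 else (1 - s) * μ z.2) (n + 1)
        (fun l (z : Bool × α) => if z.1 then g₁ l z.2 else g₀ l z.2) =
      ∑ c : OrderedFinpartition (n + 1), ∑ χ : Fin c.length → Bool,
        pairCoeff s (cT χ) (cF χ) *
          ∏ m : Fin c.length, (if χ m then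
              sahiE μ (c.partSize m) (fun r => g₁ (c.emb m r)) - sahiE μ (c.partSize m) (fun r => g₀ (c.emb m r))
            else sahiE μ (c.partSize m) (fun r => g₀ (c.emb m r))) :=
  sahiE_coin_pair μ s n g₁ g₀

end

end Summit.CriticalPhenomena.PercolationContinuityZ3.Theorems.SahiTangent
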